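import Mathlib
import HarnessLib

/-!
# Integral principal affine charts of opens of Γ-schemes (crux `UniversalCells.MatroidCellRes`, line `birth`)

Stub `stub_affineNbhd` of the skeleton `Cruxes/MatroidCellRes/Lines/birth.lean` for crux
stmt-ResolutionOfSingularities-15230 (`Summit.ResolutionOfSingularities.ResolutionOfSingularities.Theses.UniversalCells.MatroidCellRes`).
The Γ-scheme `Z_{Γ₀} = Spec (𝔽_p[a_ij : 3 × m] ⧸ (3 × 3 minors of [I₃ | A] indexed by Γ₀))` is written
out over Mathlib exactly as in the registered signature (the two `let`s of the crux, substituted);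
nothing about minors is used — the coordinate ring is treated as an arbitrary commutative ring `R`
(`exists_awayChart`).

Proof idea: the image `j(W) ⊆ Spec R` of the open immersion `j` is open, and the basic opens
`D(f)` form a basis of `Spec R` (`PrimeSpectrum.isTopologicalBasis_basic_opens`), so some
`D(f) ∋ j(w)` lies inside `j(W)`. Put `U := j⁻¹ D(f)`; the composite `U ↪ W → Spec R` has image
`D(f) = im (Spec R_f → Spec R)` (`PrimeSpectrum.localization_away_comap_range`), so it lifts along the
open immersion `Spec R_f → Spec R` to an open immersion `U → Spec R_f` (`IsOpenImmersion.lift`).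
Conversely `Spec R_f → Spec R` lifts to an open immersion `Spec R_f → W` of a non-empty scheme into
the integral scheme `W`, so `Spec R_f` is integral (`isIntegral_of_isOpenImmersion`) and `R_f` is a
domain (`affine_isIntegral_iff`).
-/

noncomputable section

-- single-problem summit: the doubled namespace component `ResolutionOfSingularities` is forced
set_option linter.dupNamespace false

open CategoryTheory AlgebraicGeometry TopologicalSpace

namespace Summit.ResolutionOfSingularities.ResolutionOfSingularities.Theorems.MatroidCellRes

universe u

/-- **Integral principal affine charts, general form**: if `j : W → Spec R` is an open immersion
and `W` is integral, every `w ∈ W` has an open neighbourhood `U` (namely `j⁻¹ D(f)` for a basic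
open `D(f) ∋ j(w)` inside the open image `j(W)`) with an open immersion `U → Spec R_f` (in fact an
isomorphism) such that `R_f` is a domain (`Spec R_f ≅ U` is a non-empty open of the integral `W`).
[folklore] -/
private theorem exists_awayChart {R : CommRingCat.{u}} {W : Scheme.{u}} (j : W ⟶ Spec R)
    [IsOpenImmersion j] [IsIntegral W] (w : W) :
    ∃ (f : R) (U : W.Opens) (e : (U : Scheme.{u}) ⟶ Spec (.of (Localization.Away f))),
      w ∈ U ∧ IsOpenImmersion e ∧ IsDomain (Localization.Away f) := by
  -- a basic open `D(f) ∋ j w` inside the open image of `j`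
  obtain ⟨_, ⟨f, rfl⟩, hwf, hfj⟩ :=
    (PrimeSpectrum.isTopologicalBasis_basic_opens (R := R)).exists_subset_of_mem_open
      (Set.mem_range_self w : j.base w ∈ Set.range j.base) j.isOpenEmbedding.isOpen_range
  -- the localisation open immersion `ιf : Spec R_f → Spec R`, with image `D(f)`
  let ιf : Spec (.of (Localization.Away f)) ⟶ Spec R :=
    Spec.map (CommRingCat.ofHom (algebraMap R (Localization.Away f)))
  have hrange : Set.range ιf.base = (PrimeSpectrum.basicOpen f : Set (PrimeSpectrum R)) :=
    PrimeSpectrum.localization_away_comap_range (Localization.Away f) f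
  -- `U := j⁻¹ D(f)`; the composite `U ↪ W → Spec R` lands in `D(f) = im ιf`
  let U : W.Opens := j ⁻¹ᵁ PrimeSpectrum.basicOpen f
  have hU : Set.range (U.ι ≫ j).base ⊆ Set.range ιf.base := by
    rw [hrange, Scheme.Hom.comp_base, TopCat.coe_comp, Set.range_comp, Scheme.Opens.range_ι]
    rintro _ ⟨x, hx, rfl⟩
    exact hx
  refine ⟨f, U, IsOpenImmersion.lift ιf (U.ι ≫ j) hU, hwf, inferInstance, ?_⟩
  -- `R_f` is a domain: `Spec R_f` is (isomorphic to) a non-empty open subscheme of the integral `W`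
  have hιj : Set.range ιf.base ⊆ Set.range j.base := hrange ▸ hfj
  haveI : Nonempty (Spec (.of (Localization.Away f)) : Scheme.{u}) := by
    have hw : j.base w ∈ Set.range ιf.base := hrange ▸ hwf
    obtain ⟨y, _⟩ := hw
    exact ⟨y⟩
  haveI := isIntegral_of_isOpenImmersion (IsOpenImmersion.lift j ιf hιj)
  exact (affine_isIntegral_iff _).mp this

/-- **(A) Integral principal affine charts around points of opens of Γ-schemes**: if
`j : W → Z_{Γ₀}` is an open immersion into the Γ-scheme
`Z_{Γ₀} = Spec (𝔽_p[a_ij : 3 × m] ⧸ (3 × 3 minors of [I₃ | A] indexed by Γ₀))` and `W` is integral,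
every `w ∈ W` has an open neighbourhood `U` with an open immersion into a principal open
`Spec (Q_{Γ₀})_f` of the Γ-scheme whose coordinate ring `(Q_{Γ₀})_f` is a domain (basic opens
`D(f) ∋ j(w)` inside the open `j(W)` form a neighbourhood basis; `j⁻¹ D(f) ≅ D(f)` is a non-empty
open of the integral `W`). [folklore] -/
theorem stub_affineNbhd (p m : ℕ) (Γ0 : Set (Fin 3 → Fin 3 ⊕ Fin m)) (W : Scheme.{0})
    (j : W ⟶ Spec (.of (
        MvPolynomial (Fin 3 × Fin m) (ZMod p) ⧸ Ideal.span ((fun u : Fin 3 → Fin 3 ⊕ Fin m => ((Matrix.fromCols (1 : Matrix (Fin 3) (Fin 3) (MvPolynomial (Fin 3 × Fin m) (ZMod p))) (Matrix.of fun i j => MvPolynomial.X (i, j))).submatrix id u).det) '' Γ0))))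
    (hj : IsOpenImmersion j) (hW : IsIntegral W) (w : W) :
    ∃ (f : MvPolynomial (Fin 3 × Fin m) (ZMod p) ⧸ Ideal.span ((fun u : Fin 3 → Fin 3 ⊕ Fin m => ((Matrix.fromCols (1 : Matrix (Fin 3) (Fin 3) (MvPolynomial (Fin 3 × Fin m) (ZMod p))) (Matrix.of fun i j => MvPolynomial.X (i, j))).submatrix id u).det) '' Γ0))
      (U : W.Opens) (e : (U : Scheme.{0}) ⟶ Spec (.of (Localization.Away f))),
      w ∈ U ∧ IsOpenImmersion e ∧ IsDomain (Localization.Away f) := by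
  haveI := hj
  haveI := hW
  exact exists_awayChart j w

end Summit.ResolutionOfSingularities.ResolutionOfSingularities.Theorems.MatroidCellRes

end
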